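import Summits.BirchSwinnertonDyer.BirchSwinnertonDyer.Theorems.PrintX9MultiPrimeHowardFrames
import Summits.BirchSwinnertonDyer.BirchSwinnertonDyer.Theorems.Rank1ResidualX9Defs
import Literature.NumberTheory.EllipticCurves.HeegnerPointsOfConductorOneGaloisConjProofs
import HarnessLib

/-!
# Crux `MultiPrimeX9` (stmt-BirchSwinnertonDyer-22889, `route-BirchSwinnertonDyer-PrintX9` rev 7,
# rank 201): the registered stub `stub_multiPrime_oddDivisibleFrames_of_twins` of birth skeleton v3
# (BC3 after the TorsionLayerDescent tribunal PASS r1, 2026-08-27T23:46Z) — the Heegner frames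
# `Odd d_K ∧ p ∣ h_K` — as KERNEL GLUE from the route's two any-class-number crux items r203
# `HowardContainmentAnyClassNumber` (stmt-BirchSwinnertonDyer-23161, shared with TorsionLayerDescent)
# and r204 `TwoSidedLinkAnyClassNumber` (stmt-BirchSwinnertonDyer-23162), modulo the named facts
# `h331` / `hChaL` / `hKo` (turnkey T-B of the PrintX9 pen, 2026-08-27T23:24:35Z)

HONEST FRAMING (cell `run/shared/lean/pub/bsd-print-x9/`, D-0131 print tier; typer seat ty3 serving the
pen's turnkey T-B — hence the file lives in the cell's typer tree `Rank1Residual/X9/`, not under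
`BirchSwinnertonDyer/Theorems/` (prover-only, D-0016); the proof is attached as evidence on item 22889):
THEOREMS ONLY, nothing booked, nothing closed. ROUTE-FREE: no `Theses.*` import — the two items are taken
as hypotheses by their definientia VERBATIM (`Theses/PrintX9.lean` rev 7 ll. 282–283 / 297–298 =
`Theses/TorsionLayerDescent.lean` items 23161 / 23162, text-equal), so a consumer holding
`hA : Theses.PrintX9.HowardContainmentAnyClassNumber` / `hB : Theses.PrintX9.TwoSidedLinkAnyClassNumber`
feeds them by δ-unfolding. The crux `MultiPrimeX9` is NOT closed by this file: its OPEN inputs are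
exactly `hA` / `hB` (BEYOND PRINT: every any-`h_K` INTEGRAL containment is printed only at `p ≥ 5`
under hypotheses the X9 frames violate or do not carry — Burungale–Castella–Kim 2021 Thm. 3.1 (by
citation), Howard 2007 §3.3 (`p ∤ 6N`, δ-defect), Fouquet 2013; Mastella–Zerman 2026 Cor. 4.6 needs
`p ∤ h_K`; cell DOSSIER §41) and the `d_K`-even frames (`stub_multiPrime_evenDiscFrames`, spurious at
route level, PLAN §7(g)). «beyond-print theorem»: NO (conditional glue; open inputs = items 23161 /
23162 + cite-only h331/hChaL/hKo). BSD is not proved by any of this.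

WHAT.
* `indexIdentityAt_of_heegnerPoint_of_twins_of_thm331` — the Heegner-index identity over `K`
  (`X11b.IndexIdentityAt W p K P`: `2·ord_p ∏ c_ℓ(E) + ord_p #Ш(E/K) = 2·ord_p [E(K):ℤP]`) at a
  Manin-unit Heegner datum of an X9 pair (`p ≥ 5` good ordinary, `E[p]` irreducible, `ρ̄_{E,p}` not
  onto, non-CM) over a Heegner field with `p` split, `d_K` odd `< −4`, Heegner point of infinite order —
  with NO class-number hypothesis: the twin of p4's
  `Rank1Residual.X9.indexIdentityAt_of_heegnerPoint_of_cor46_of_thm331`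
  (`Theorems/PrintX9MultiPrimeHowardFrames.lean` §1) in which the two use-sites of `p ∤ h_K` (l.127
  Howard's containment from Mastella–Zerman Cor. 4.6, `h46`; l.129–130 the two-sided link from the
  Yan–Zhu/BCS/CGLS composite, `hYZ`) are fed instead by `hA` / `hB`, the census class predicate
  `Literature.….Rank1Residual.ClassX9` being converted to the items' `Summit.….Rank1Residual.ClassX9`
  by the tree lemma `classX9_of_classX9_census`; everything else VERBATIM.
* `stub_multiPrime_oddDivisibleFrames_of_twins_of_namedFacts (h331) (hChaL) (hKo) : ‹A› → ‹B› → ‹S›` —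
  the registered stub BY SIGNATURE (‹S› VERBATIM = the conclusion of `stub_multiPrime_oddDivisibleFrames_of_twins`
  in `run/shared/lean/pub/bsd-print-x9/plan/skeletons/MultiPrimeX9_birth_v3.lean`: frames
  `Odd d_K ∧ p ∣ h_K`, all depths `s ≤ ord_p ∏ c_q`, bound `B = 4`): the twin of p4's
  `multiPrime_oddCoprimeFrames_of_namedFacts` (ibid. §2: Cha's LOWER half `hChaL` against the identity
  above; the frame clause `p ∣ h_K`, `r_an ≤ 1` and the multi-carrier clause are not used), with
  Shimura reciprocity at conductor `1` DISCHARGED by the tree theorem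
  `heegnerPointOfConductor_one_galoisConj_holds`.
With p577139 (`stub_multiPrime_oddCoprimeFrames`) and the skeleton's `MultiPrimeX9_of`, the crux is thereby
reduced IN THE KERNEL to items 23161 ∧ 23162 and the `d_K`-even stub, modulo the cell's named facts.

References: [Cha2005] Thm. 21, Rmk. 25; [JetchevSkinnerWan2017] Thm. 3.3.1; [Kolyvagin1990] Thm. A;
[MatarNekovar2019] Prop. 5.26 (2); [McCallumLMS1991] §5 Lemma 5.1; [GrossLMS1991] §2 Conj. (2.2);
[Darmon2004] Thm. 3.7; [Jetchev2008] Conj. 1.3; [Howard2004HeegnerKolyvagin] Thm. B;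
[CastellaGrossiLeeSkinner2022] Thm. 4.1.1; route files `Theses/PrintX9.lean` (rev 7, items 22889 /
23161 / 23162) and `Theses/TorsionLayerDescent.lean` (rev 0) — texts only, not imported.
-/

-- the REGISTERED stub namespace `Summit.BirchSwinnertonDyer.BirchSwinnertonDyer.Cruxes.…` repeats the summit name
set_option linter.dupNamespace false
set_option autoImplicit false

noncomputable section

open scoped Classical MatrixGroups ModularForm

open CongruenceSubgroup WeierstrassCurve NumberField IsDedekindDomain
  Literature.NumberTheory.EllipticCurves Literature.NumberTheory.EllipticCurves.ModularForms
  Literature.NumberTheory.EllipticCurves.JetchevSkinnerWan2017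
  Literature.NumberTheory.EllipticCurves.YanZhu2026
  Summit.BirchSwinnertonDyer.BirchSwinnertonDyer.Theorems.Rank1ResidualX1Defs
  Summit.BirchSwinnertonDyer.Rank1Residual
  Summit.BirchSwinnertonDyer.Rank1Residual.X11b.Three.Koly
  Summit.BirchSwinnertonDyer.Rank1Residual.X11b.KolyvaginBottom
  Summit.BirchSwinnertonDyer.BirchSwinnertonDyer.Rank1Residual

namespace Summit.BirchSwinnertonDyer.BirchSwinnertonDyer.Cruxes.MultiPrimeX9.HowardFrames

/-! ### §1 The Heegner-index identity over `K` on X9 frames, ANY class number — from the two items -/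

/-- **The Heegner-index identity over `K` at a Manin-unit Heegner datum of an X9 pair (`p ≥ 5` good
ordinary, `E[p]` irreducible, `ρ̄_{E,p}` not onto, non-CM) over a Heegner field with `p` split, `d_K`
odd `< −4`, whose Heegner point `P` has INFINITE ORDER — with NO class-number hypothesis**, granted the
two any-class-number items: Howard's containment (`hA`, = item 23161 `HowardContainmentAnyClassNumber`
by its definiens) and the two-sided IMC∘BDP link granted the containment (`hB`, = item 23162
`TwoSidedLinkAnyClassNumber` by its definiens). Rank one and finiteness over `K` by Kolyvagin (`hKo`),
(irr_K) by the Matar–Nekovář theorem, anticyclotomic control by JSW Thm. 3.3.1 (`h331`). The twin of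
`Rank1Residual.X9.indexIdentityAt_of_heegnerPoint_of_cor46_of_thm331` with its two `p ∤ h_K` use-sites
replaced by `hA` / `hB` (class predicate converted by `classX9_of_classX9_census`) and the binder
`p ∤ h_K` deleted.
[cite: JetchevSkinnerWan2017, Thm. 3.3.1, §7.3.1 (eq:tamK)] [cite: Kolyvagin1990, Thm. A]
[cite: MatarNekovar2019, Prop. 5.26 (2)] [cite: GrossLMS1991, §2 Conj. (2.2)]
[cite: Howard2004HeegnerKolyvagin, Thm. B (the containment, there under p ∤ h_K)] -/
theorem indexIdentityAt_of_heegnerPoint_of_twins_of_thm331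
    (hA : ∀ (W : WeierstrassCurve ℚ) [W.IsElliptic] [W.IsGloballyMinimal] (p : ℕ) [Fact p.Prime] [NeZero (W.conductorNorm ℤ)] (K : Type) [Field K] [NumberField K], Summit.BirchSwinnertonDyer.BirchSwinnertonDyer.Rank1Residual.ClassX9 W p → Literature.NumberTheory.EllipticCurves.IsImaginaryQuadratic K → NumberField.discr K ≠ -3 → NumberField.discr K ≠ -4 → Literature.NumberTheory.EllipticCurves.SatisfiesHeegnerHypothesis (W.conductorNorm ℤ) K → Literature.NumberTheory.EllipticCurves.SatisfiesHeegnerHypothesis p K → ∀ (κ : Literature.NumberTheory.EllipticCurves.ZpExtension K p), κ.IsAnticyclotomic → ∀ (γ : Field.absoluteGaloisGroup K), κ.IsTopGenerator γ → ∀ (Dt : Literature.NumberTheory.EllipticCurves.ModularForms.ModularParametrizationData W (W.conductorNorm ℤ)) (H : Literature.NumberTheory.EllipticCurves.HeegnerDatum (W.conductorNorm ℤ) (NumberField.discr K)) (ιC : K →+* ℂ), ∃ (jbar : AlgebraicClosure K →+* ℂ) (D : (W.baseChange K).LambdaAdicSelmerData κ γ) (F : Literature.NumberTheory.EllipticCurves.HeegnerFamily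 (W.conductorNorm ℤ) W K κ jbar) (X : (W.baseChange K).SelmerDualData κ γ), Literature.NumberTheory.EllipticCurves.heegnerCharIdeal D F ^ 2 ≤ Literature.NumberTheory.EllipticCurves.Module.charIdeal (Literature.NumberTheory.EllipticCurves.IwasawaAlgebra p) (Submodule.torsion (Literature.NumberTheory.EllipticCurves.IwasawaAlgebra p) X.X))
    (hB : ∀ (W : WeierstrassCurve ℚ) [W.IsElliptic] [W.IsGloballyMinimal] (p : ℕ) [Fact p.Prime] [NeZero (W.conductorNorm ℤ)] (K : Type) [Field K] [NumberField K], Summit.BirchSwinnertonDyer.BirchSwinnertonDyer.Rank1Residual.ClassX9 W p → Literature.NumberTheory.EllipticCurves.IsImaginaryQuadratic K → Odd (NumberField.discr K) → NumberField.discr K ≠ -3 → Literature.NumberTheory.EllipticCurves.SatisfiesHeegnerHypothesis (W.conductorNorm ℤ) K → Literature.NumberTheory.EllipticCurves.SatisfiesHeegnerHypothesis p K → (W.baseChange K).HasIrreducibleModPGaloisRep p → ∀ (ι : K →+* ℚ_[p]) (κ : Literature.NumberTheory.EllipticCurves.ZpExtension K p), κ.IsAnticyclotomic → ∀ (γ :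 Field.absoluteGaloisGroup K) [Fact (κ.IsTopGenerator γ)] (Dt : Literature.NumberTheory.EllipticCurves.ModularForms.ModularParametrizationData W (W.conductorNorm ℤ)), ¬ (p : ℤ) ∣ Dt.c → ∀ (H : Literature.NumberTheory.EllipticCurves.HeegnerDatum (W.conductorNorm ℤ) (NumberField.discr K)) (ιC : K →+* ℂ) (P : (W.baseChange K).toAffine.Point), WeierstrassCurve.Affine.Point.map ιC.toRatAlgHom P = Literature.NumberTheory.EllipticCurves.ModularForms.heegnerPointComplex Dt H → (W.baseChange K).mordellWeilRank = 1 → Finite (AddCommGroup.primaryComponent (W.baseChange K).sha p) → ¬ IsOfFinAddOrder P → (∃ (jbar : AlgebraicClosure K →+* ℂ) (D : (W.baseChange K).LambdaAdicSelmerData κ γ) (F : Literature.NumberTheory.EllipticCurves.HeegnerFamily (W.conductorNorm ℤ) W K κ jbar) (X : (W.baseChange K).SelmerDualData κ γ), Literature.NumberTheory.EllipticCurves.heegnerCharIdeal D F ^ 2 ≤ Literature.NumberTheory.EllipticCurves.Module.charIdeal (Literature.NumberTheory.EllipticCurves.IwasawaAlgebra p) (Submodule.torsion (Literature.NumberTheory.EllipticCurves.IwasawaAlgebra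 p) X.X)) → Summit.BirchSwinnertonDyer.Rank1Residual.X11b.IMCWaldspurgerOnTreeGoodAt p κ (Summit.BirchSwinnertonDyer.Rank1Residual.X11b.inducedPlace ι) γ ι P)
    (h331 : thm331_anticyclotomicControl)
    (W : WeierstrassCurve ℚ) [W.IsElliptic] [W.IsGloballyMinimal] [NeZero (W.conductorNorm ℤ)]
    (p : ℕ) [Fact p.Prime] (hX9 : Literature.NumberTheory.EllipticCurves.Rank1Residual.ClassX9 W p)
    (K : Type) [Field K] [NumberField K] (hKo : kolyvagin (W.conductorNorm ℤ) W K)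
    (hK : IsImaginaryQuadratic K) (hodd : Odd (NumberField.discr K)) (hlt : NumberField.discr K < -4)
    (hHN : SatisfiesHeegnerHypothesis (W.conductorNorm ℤ) K) (hHp : SatisfiesHeegnerHypothesis p K)
    (Dt : ModularParametrizationData W (W.conductorNorm ℤ))
    (H : HeegnerDatum (W.conductorNorm ℤ) (NumberField.discr K)) (ιC : K →+* ℂ)
    (P : (W.baseChange K).toAffine.Point)
    (hP : WeierstrassCurve.Affine.Point.map ιC.toRatAlgHom P = heegnerPointComplex Dt H)
    (hPinf : ¬ IsOfFinAddOrder P) (hc : ¬ (p : ℤ) ∣ Dt.c) : X11b.IndexIdentityAt W p K P := by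
  have hpP : p.Prime := Fact.out
  have hp2 : p ≠ 2 := hX9.ne_two
  have hp5 : 5 ≤ p := hX9.five_le
  have h3 : NumberField.discr K ≠ -3 := by omega
  have h4 : NumberField.discr K ≠ -4 := by omega
  -- the items speak the summit-side class predicate
  have hX9S : Summit.BirchSwinnertonDyer.BirchSwinnertonDyer.Rank1Residual.ClassX9 W p :=
    classX9_of_classX9_census W p hX9
  -- rank one and finiteness over `K` (Kolyvagin, from the non-torsion Heegner point)
  obtain ⟨hrk, hshaK⟩ := hKo hK hHN ⟨Dt, H, ιC, hP⟩ hPinf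
  haveI : Finite (W.baseChange K).sha := hshaK
  have hfinp : Finite (AddCommGroup.primaryComponent (W.baseChange K).sha p) :=
    Finite.of_injective _ Subtype.val_injective
  -- (irr_K) at this field (Matar–Nekovář Prop. 5.26 (2), a tree theorem)
  have hirrK : (W.baseChange K).HasIrreducibleModPGaloisRep p :=
    MatarNekovar2019.prop526_hasIrreducibleModPGaloisRep_baseChange_holds W K hK.1
      (Literature.SatisfiesHeegnerHypothesis.coprime_discr hK.1 hHN) p hp2 hX9.irr
  -- the anticyclotomic datum and the embedding at a prime above `p`
  obtain ⟨κ, γ, 𝔭, hκ, hγ, h𝔭⟩ := X11b.exists_anticyclotomic_generator_prime (p := p) hK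
  haveI : Fact (κ.IsTopGenerator γ) := ⟨hγ⟩
  have hsplit : X11b.SplitsIn K p := hHp p Fact.out (dvd_refl p)
  obtain ⟨he, hf⟩ := X11b.degreeOne_of_splitsIn hK.1 hsplit h𝔭
  set ι : K →+* ℚ_[p] := X11b.embAt K p 𝔭 h𝔭 he hf with hι
  have hCTL : X11b.ControlOnTreeGoodAt p κ (X11b.inducedPlace ι) γ ι P :=
    X11b.controlOnTreeGoodAt_of_thm331_of_inducedPlace h331 (by omega) hX9.good hK hHp rfl hHN hirrK ι
      κ hκ γ hrk hfinp P hPinf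
  -- Howard's containment at the frame, ANY class number (item 23161)
  have hHow := hA W p K hX9S hK h3 h4 hHN hHp κ hκ γ hγ Dt H ιC
  -- the two-sided link granted the containment, ANY class number (item 23162)
  have hIW : X11b.IMCWaldspurgerOnTreeGoodAt p κ (X11b.inducedPlace ι) γ ι P :=
    hB W p K hX9S hK hodd h3 hHN hHp hirrK ι κ hκ γ Dt hc H ιC P hP hrk hfinp hPinf hHow
  exact X11b.indexIdentityAt_of_onTreeGoodLinks_of_allSplit hK rfl hHN hIW hCTL

/-! ### §2 The registered stub `stub_multiPrime_oddDivisibleFrames_of_twins` of crux 22889, from named facts -/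

/-- **Stub `stub_multiPrime_oddDivisibleFrames_of_twins` of crux `MultiPrimeX9` (item 22889),
registered signature (skeleton v3) with the two items by their definientia, modulo THREE named facts**
(`h331` JSW Thm. 3.3.1, `hChaL` Cha Rmk. 25 lower half, `hKo` Kolyvagin Thm. A; Shimura reciprocity
at conductor `1` is supplied by the tree theorem `heegnerPointOfConductor_one_galoisConj_holds`):
GRANTED items 23161 (Howard containment, any class number) and 23162 (two-sided link granted the
containment, any class number), on every X9 Heegner frame (`p ≥ 5` good ordinary, `E[p]` irreducible,
`ρ̄_{E,p}` not onto, non-CM; `K` imaginary quadratic, Heegner for `N_E`, `p` split, Manin-good, `y_K`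
of infinite order) with `d_K` ODD and `p ∣ h_K`, every derived Heegner point `P_n` on Kolyvagin primes
of index `≥ s` is `p^s`-divisible in `E(K[n])` for ALL `s ≤ ord_p ∏ c_q(E)` (bound `B = 4`). Proof =
the twin of `Rank1Residual.multiPrime_oddCoprimeFrames_of_namedFacts`: a non-divisible `P_n` at depth
`s ≤ t` is a level-`s` certificate ⇒ `2(M₀ − s + 1) ≤ ord_p #Ш(E/K)` (Cha's lower half), against the
identity `ord_p #Ш(E/K) = 2M₀ − 2t` of §1; `p ∣ h_K`, `r_an ≤ 1` and the multi-carrier clause are not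
used. NO Jetchev, NO Kolyvagin conjecture, NO (sur)/(im).
[cite: Cha2005, Thm. 21 and Rmk. 25 (pp. 173–175)] [cite: JetchevSkinnerWan2017, Thm. 3.3.1]
[cite: Kolyvagin1990, Thm. A] [cite: McCallumLMS1991, §5 Lemma 5.1, Cor. 5.6] [cite: Darmon2004, Thm. 3.7]
[cite: MatarNekovar2019, Thm. 0.7, §0.9, §0.11] [cite: Jetchev2008, Conj. 1.3, Thm. 1.4] -/
theorem stub_multiPrime_oddDivisibleFrames_of_twins_of_namedFacts
    (h331 : thm331_anticyclotomicControl)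
    (hChaL : Cha2005.rmk25_pow_dvd_card_sha_primary_of_certificate)
    (hKo : ∀ (N : ℕ) [NeZero N] (W : WeierstrassCurve ℚ) (K : Type) [Field K] [NumberField K],
      kolyvagin N W K) :
    (∀ (W : WeierstrassCurve ℚ) [W.IsElliptic] [W.IsGloballyMinimal] (p : ℕ) [Fact p.Prime] [NeZero (W.conductorNorm ℤ)] (K : Type) [Field K] [NumberField K], Summit.BirchSwinnertonDyer.BirchSwinnertonDyer.Rank1Residual.ClassX9 W p → Literature.NumberTheory.EllipticCurves.IsImaginaryQuadratic K → NumberField.discr K ≠ -3 → NumberField.discr K ≠ -4 → Literature.NumberTheory.EllipticCurves.SatisfiesHeegnerHypothesis (W.conductorNorm ℤ) K → Literature.NumberTheory.EllipticCurves.SatisfiesHeegnerHypothesis p K → ∀ (κ : Literature.NumberTheory.EllipticCurves.ZpExtension K p), κ.IsAnticyclotomic → ∀ (γ : Field.absoluteGaloisGroup K), κ.IsTopGenerator γ → ∀ (Dt : Literature.NumberTheory.EllipticCurves.ModularForms.ModularParametrizationData W (W.conductorNorm ℤ)) (H : Literature.NumberTheory.EllipticCurves.HeegnerDatum (W.conductorNorm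 ℤ) (NumberField.discr K)) (ιC : K →+* ℂ), ∃ (jbar : AlgebraicClosure K →+* ℂ) (D : (W.baseChange K).LambdaAdicSelmerData κ γ) (F : Literature.NumberTheory.EllipticCurves.HeegnerFamily (W.conductorNorm ℤ) W K κ jbar) (X : (W.baseChange K).SelmerDualData κ γ), Literature.NumberTheory.EllipticCurves.heegnerCharIdeal D F ^ 2 ≤ Literature.NumberTheory.EllipticCurves.Module.charIdeal (Literature.NumberTheory.EllipticCurves.IwasawaAlgebra p) (Submodule.torsion (Literature.NumberTheory.EllipticCurves.IwasawaAlgebra p) X.X)) →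
    (∀ (W : WeierstrassCurve ℚ) [W.IsElliptic] [W.IsGloballyMinimal] (p : ℕ) [Fact p.Prime] [NeZero (W.conductorNorm ℤ)] (K : Type) [Field K] [NumberField K], Summit.BirchSwinnertonDyer.BirchSwinnertonDyer.Rank1Residual.ClassX9 W p → Literature.NumberTheory.EllipticCurves.IsImaginaryQuadratic K → Odd (NumberField.discr K) → NumberField.discr K ≠ -3 → Literature.NumberTheory.EllipticCurves.SatisfiesHeegnerHypothesis (W.conductorNorm ℤ) K → Literature.NumberTheory.EllipticCurves.SatisfiesHeegnerHypothesis p K → (W.baseChange K).HasIrreducibleModPGaloisRep p → ∀ (ι : K →+* ℚ_[p]) (κ : Literature.NumberTheory.EllipticCurves.ZpExtension K p), κ.IsAnticyclotomic → ∀ (γ : Field.absoluteGaloisGroup K) [Fact (κ.IsTopGenerator γ)] (Dt : Literature.NumberTheory.EllipticCurves.ModularForms.ModularParametrizationData W (W.conductorNorm ℤ)), ¬ (p : ℤ) ∣ Dt.c → ∀ (H : Literature.NumberTheory.EllipticCurves.HeegnerDatum (W.conductorNorm ℤ) (NumberField.discr K)) (ιC : K →+* ℂ) (P : (W.baseChange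 K).toAffine.Point), WeierstrassCurve.Affine.Point.map ιC.toRatAlgHom P = Literature.NumberTheory.EllipticCurves.ModularForms.heegnerPointComplex Dt H → (W.baseChange K).mordellWeilRank = 1 → Finite (AddCommGroup.primaryComponent (W.baseChange K).sha p) → ¬ IsOfFinAddOrder P → (∃ (jbar : AlgebraicClosure K →+* ℂ) (D : (W.baseChange K).LambdaAdicSelmerData κ γ) (F : Literature.NumberTheory.EllipticCurves.HeegnerFamily (W.conductorNorm ℤ) W K κ jbar) (X : (W.baseChange K).SelmerDualData κ γ), Literature.NumberTheory.EllipticCurves.heegnerCharIdeal D F ^ 2 ≤ Literature.NumberTheory.EllipticCurves.Module.charIdeal (Literature.NumberTheory.EllipticCurves.IwasawaAlgebra p) (Submodule.torsion (Literature.NumberTheory.EllipticCurves.IwasawaAlgebra p) X.X)) → Summit.BirchSwinnertonDyer.Rank1Residual.X11b.IMCWaldspurgerOnTreeGoodAt p κ (Summit.BirchSwinnertonDyer.Rank1Residual.X11b.inducedPlace ι) γ ι P) →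
    ∀ (W : WeierstrassCurve ℚ) [W.IsElliptic] [W.IsGloballyMinimal] [NeZero (W.conductorNorm ℤ)] (p : ℕ) [Fact p.Prime], Literature.NumberTheory.EllipticCurves.Rank1Residual.ClassX9 W p → W.analyticRank ≤ 1 → ¬ (∃ (q : ℕ) (_ : Fact q.Prime), q ∣ W.conductorNorm ℤ ∧ padicValNat p W.tamagawaProduct ≤ padicValNat p ((W.baseChange ℚ_[q]).localTamagawaNumber ℤ_[q])) → ∃ B : ℕ, ∀ (K : Type) [Field K] [NumberField K] (Dt : Literature.NumberTheory.EllipticCurves.ModularForms.ModularParametrizationData W (W.conductorNorm ℤ)) (β : ℤ) (ι : K →+* ℂ), Literature.NumberTheory.EllipticCurves.IsImaginaryQuadratic K → B < (NumberField.discr K).natAbs → Literature.NumberTheory.EllipticCurves.SatisfiesHeegnerHypothesis (W.conductorNorm ℤ) K → Literature.NumberTheory.EllipticCurves.SatisfiesHeegnerHypothesis p K → (Odd (NumberField.discr K) ∧ p ∣ NumberField.classNumber K) → (4 * (W.conductorNorm ℤ : ℤ)) ∣ β ^ 2 - NumberField.discr K → ¬ (p : ℤ) ∣ Dt.c → ∀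 (d₁ : Literature.NumberTheory.EllipticCurves.KolyvaginHeegnerData Dt β ι 1), ¬ IsOfFinAddOrder d₁.derivedPoint → ∀ (s : ℕ), s ≤ padicValNat p W.tamagawaProduct → ∀ (n : ℕ) (d : Literature.NumberTheory.EllipticCurves.KolyvaginHeegnerData Dt β ι n), Squarefree n → (∀ ℓ ∈ n.primeFactors, Literature.NumberTheory.EllipticCurves.Zhang2014.IsKolyvaginPrime (W.conductorNorm ℤ) W K p ℓ ∧ s ≤ Literature.NumberTheory.EllipticCurves.Zhang2014.kolyvaginIndex W p ℓ) → ∃ Q : (W.baseChange (Literature.NumberTheory.EllipticCurves.ringClassField K ι n)).toAffine.Point, ((p ^ s : ℕ) : ℤ) • Q = d.derivedPoint := by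
  intro hA hB W _ _ _ p _ hX9 _ _
  refine ⟨4, ?_⟩
  intro K _ _ Dt β ι hK hBK hHN hHp hfr hβ hc d₁ hd₁ s hs n d hn hℓ
  obtain ⟨hodd, -⟩ := hfr
  -- Shimura reciprocity at conductor `1`: a tree THEOREM (Darmon Thm. 3.7)
  have hrec : ∀ (N : ℕ) [NeZero N] (W : WeierstrassCurve ℚ) (K : Type) [Field K] [NumberField K],
      heegnerPointOfConductor_one_galoisConj N W K :=
    fun N _ W K _ _ ↦ heegnerPointOfConductor_one_galoisConj_holds N W K
  have hpP : p.Prime := Fact.out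
  have hp2 : p ≠ 2 := hX9.ne_two
  have hneg : NumberField.discr K < 0 := IsImaginaryQuadratic.discr_neg hK
  have hlt : NumberField.discr K < -4 := by omega
  have h3 : NumberField.discr K ≠ -3 := by omega
  have h4 : NumberField.discr K ≠ -4 := by omega
  have hpd : ¬ (p : ℤ) ∣ NumberField.discr K :=
    Literature.SatisfiesHeegnerHypothesis.not_dvd_discr hK.1 hHp hpP (dvd_refl p)
  have hpN : ¬ p ∣ W.conductorNorm ℤ := fun h ↦
    (W.dvd_conductorNorm_iff_not_hasGoodReductionAtPrime p).mp h hX9.good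
  have hpN2 : ¬ p ^ 2 ∣ W.conductorNorm ℤ := fun h ↦ hpN (dvd_trans (dvd_pow_self p two_ne_zero) h)
  -- depth `0` is trivial
  rcases Nat.eq_zero_or_pos s with rfl | hs1
  · exact ⟨d.derivedPoint, by rw [pow_zero, Nat.cast_one, one_zsmul]⟩
  -- the oriented Heegner datum of the frame and THE Heegner point `y_K ∈ E(K)`
  obtain ⟨H, hHβ⟩ := exists_heegnerDatum (W.conductorNorm ℤ) hneg hβ
  obtain ⟨P, hP⟩ := heegnerPointComplex_mem_range_map_holds (W.conductorNorm ℤ) W K hK hHN Dt H ι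
  have hPd : d₁.toGeomPoints d₁.derivedPoint = toGeomPoints (W.baseChange K) P :=
    toGeomPoints_derivedPoint_one_eq (hrec _ W K) hK hHN hP d₁ hHβ
  have hPinf : ¬ IsOfFinAddOrder P := fun hfin ↦
    hd₁ ((isOfFinAddOrder_derivedPoint_one_iff (hrec _ W K) hK hHN hP d₁ hHβ).mpr hfin)
  -- the identity over `K` at this frame, ANY class number (§1, from the items)
  have hid := indexIdentityAt_of_heegnerPoint_of_twins_of_thm331 hA hB h331 W p hX9 K (hKo _ W K)
    hK hodd hlt hHN hHp Dt H ι P hP hPinf hc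
  -- rank one and finiteness over `K` (Kolyvagin), no `p`-torsion (irreducibility)
  obtain ⟨hrank, hshaK⟩ := hKo (W.conductorNorm ℤ) W K hK hHN ⟨Dt, H, ι, hP⟩ hPinf
  haveI : Finite (W.baseChange K).sha := hshaK
  haveI hfinp : Finite (AddCommGroup.primaryComponent (W.baseChange K).sha p) :=
    Finite.of_injective _ Subtype.val_injective
  have hbot := torsionBy_eq_bot_of_isImaginaryQuadratic_of_hasIrreducibleModPGaloisRep W K hK hpP hX9.irr
  have hiv : ∀ x : (W.baseChange K).toAffine.Point, p • x = 0 → x = 0 := fun x hx ↦ by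
    have hmem : x ∈ AddSubgroup.torsionBy (W.baseChange K).toAffine.Point ((p : ℕ) : ℤ) := by
      rw [mem_torsionBy_iff, natCast_zsmul]
      exact hx
    rw [hbot] at hmem
    exact hmem
  -- the exponent `p^{M₀} ∥ y_K` in `E(K)` and `ord_p [E(K):ℤy_K] = M₀` (McCallum Lemma 5.1)
  haveI : Module.Finite ℤ (W.baseChange K).toAffine.Point := (W.baseChange K).module_finite_point_holds
  obtain ⟨M₀, x₀, hx₀, hmax⟩ := exists_pow_smul_eq_and_forall_ne hPinf (p := p) hpP.two_le
  have hdiv : ∃ Q : (W.baseChange K).toAffine.Point, ((p ^ M₀ : ℕ) : ℤ) • Q = P :=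
    ⟨x₀, by rw [natCast_zsmul]; exact hx₀⟩
  have hndiv : ¬ ∃ Q : (W.baseChange K).toAffine.Point, ((p ^ (M₀ + 1) : ℕ) : ℤ) • Q = P := by
    rintro ⟨Q, hQ⟩
    exact hmax Q (by rw [← natCast_zsmul]; exact hQ)
  haveI : Finite (AddCommGroup.torsion (W.baseChange K).toAffine.Point) :=
    WeierstrassCurve.finite_torsion_point (W := W.baseChange K)
  obtain ⟨c, Q, hcQ, hcker⟩ := X11b.RankOne.exists_coord_of_mordellWeilRank_eq_one (W.baseChange K) hrank
  have hidx : padicValNat p (AddSubgroup.zmultiples P).index = M₀ :=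
    padicValNat_index_zmultiples_eq_of_divisibility c Q hcQ hcker hiv P hdiv hndiv
  -- suppose `P_n ∉ p^s E(K_n)`: a level-`s` certificate; Cha's LOWER half bounds `#Ш` from below
  by_contra hQ
  have hcert := hChaL W hX9.not_hasCM K hK h3 h4 hHN p hp2 hpd hpN2 hX9.irr Dt β ι d₁ P hPd hPinf M₀
    hdiv hndiv n (s - 1) d hn
    (fun ℓ hℓ' ↦ ⟨(hℓ ℓ hℓ').1, by have := (hℓ ℓ hℓ').2; omega⟩)
    (by rw [Nat.sub_add_cancel hs1]; exact hQ)
  have hle : 2 * (M₀ - (s - 1)) ≤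
      padicValNat p (Nat.card (AddCommGroup.primaryComponent (W.baseChange K).sha p)) :=
    (padicValNat_dvd_iff_le Nat.card_pos.ne').mp hcert
  rw [padicValNat_card_addPrimaryComponent (A := (W.baseChange K).sha) p] at hle
  -- the identity: `2t + ord_p #Ш(E/K) = 2M₀`
  unfold X11b.IndexIdentityAt at hid
  rw [WeierstrassCurve.shaOrder, hidx] at hid
  omega

end Summit.BirchSwinnertonDyer.BirchSwinnertonDyer.Cruxes.MultiPrimeX9.HowardFrames

end
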